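import Mathlib
import Literature.NumberTheory.Sieve.BatemanHorn
import Literature.NumberTheory.Sieve.BatemanHornProofs
import HarnessLib

/-!
# Route `SelbergDelangeRigidity`, crux `LSDRealSegment` (stmt-Parity-9770): vocabulary of the line `product-anatomy-subcritical`

Route-posited objects (D-0016 `<Route>Defs` file) shared by the registered stubs of the checked skeleton
`Cruxes/LSDRealSegment/Lines/product_anatomy_subcritical.lean` and by the crux file composing them. Nothing is
asserted: definitions over Mathlib and `Literature.NumberTheory.Sieve`, the divisor-expansion identities of the
line (`y^{Ω(m)} = Σ_{d ∣ m} g_y(d)`, `Ω_f(n) = Ω(P(n))`, the exact split `M_x = T_x + K_x`), the explicit Euler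
factor `λ_F = eulerFactor f` with `λ_F(1) = 1` and the PIN `λ_F(0) = C(f)` (from the proved
`IsBatemanHornSystem.hasBatemanHornConst_holds`), and the NAMED PREDICATES the stubs are typed in
(`EulerFactorClause`, `TypeILawOmega`, `KernelLawOmega`, `APrioriBound`, `RankinTail`, `TopClassBound`,
`BalancedClassBound`, `CheapRows`); cf. `Lines/product-anatomy-subcritical.md`, Tenenbaum 2015 II.5–II.6.
-/

open Filter Finset Polynomial
open scoped BigOperators Topology Classical

namespace Summit.Parity.BatemanHorn.Cruxes.LSDRealSegment.ProductAnatomySubcritical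

open Literature.NumberTheory.Sieve
open ArithmeticFunction (cardFactors)
noncomputable section
/-! ### Weights: the completely-multiplicative Möbius transform `g_y` of `y^{Ω}` -/

section Weights
variable {R : Type*} [CommRing R]

/-- Local coefficients of `g_y`: `g_y(p⁰) = 1`, `g_y(p^{a+1}) = (y − 1) y^a` (all `≥ 0` for real `y ≥ 1`;
NOT capped — the un-capped statistic of this crux). [folklore] -/
def omegaCoeff (y : R) : ℕ → R
  | 0 => 1
  | a + 1 => (y - 1) * y ^ a

/-- `g_y(p⁰) = 1`. [folklore] -/
@[simp] theorem omegaCoeff_zero (y : R) : omegaCoeff y 0 = 1 := rfl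

/-- `g_y(p^{a+1}) = (y − 1) y^a`. [folklore] -/
@[simp] theorem omegaCoeff_succ (y : R) (a : ℕ) : omegaCoeff y (a + 1) = (y - 1) * y ^ a := rfl

/-- The divisor weight `g_y(d) = ∏_{p^a ∥ d} (y − 1) y^{a−1}`, multiplicative, with
`y^{Ω(m)} = Σ_{d ∣ m} g_y(d)` for `m ≥ 1` (`g_y(0) = 1` is junk, never summed). [folklore] -/
def omegaWeight (y : R) (d : ℕ) : R :=
  d.factorization.prod fun _ a => omegaCoeff y a

/-- `g_y(p^j) = omegaCoeff y j` at a prime power. [folklore] -/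
theorem omegaWeight_prime_pow (y : R) {p : ℕ} (hp : p.Prime) (j : ℕ) :
    omegaWeight y (p ^ j) = omegaCoeff y j := by
  rw [omegaWeight, hp.factorization_pow, Finsupp.prod_single_index]
  exact omegaCoeff_zero y

/-- `g_y` is multiplicative on coprime non-zero arguments. [folklore] -/
theorem omegaWeight_mul (y : R) {m n : ℕ} (hm : m ≠ 0) (hn : n ≠ 0) (h : m.Coprime n) :
    omegaWeight y (m * n) = omegaWeight y m * omegaWeight y n := by
  unfold omegaWeight
  rw [Nat.factorization_mul hm hn, Finsupp.prod_add_index_of_disjoint]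
  simpa only [Nat.support_factorization] using h.disjoint_primeFactors

/-- Telescoping: `Σ_{j ≤ a} g_y(p^j) = y^a`. [folklore] -/
theorem sum_omegaCoeff_range (y : R) (a : ℕ) : ∑ j ∈ range (a + 1), omegaCoeff y j = y ^ a := by
  induction a with
  | zero => simp
  | succ a ih => rw [Finset.sum_range_succ, ih, omegaCoeff_succ]; ring

/-- `g_y` as an arithmetic function (`0 ↦ 0`). [folklore] -/
def omegaArith (y : R) : ArithmeticFunction R :=
  ⟨fun d => if d = 0 then 0 else omegaWeight y d, by simp⟩

/-- `omegaArith y d = g_y(d)` for `d ≠ 0`. [folklore] -/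
theorem omegaArith_apply (y : R) {d : ℕ} (hd : d ≠ 0) : omegaArith y d = omegaWeight y d := by
  simp [omegaArith, hd]

/-- `g_y` is a multiplicative arithmetic function. [folklore] -/
theorem isMultiplicative_omegaArith (y : R) : (omegaArith y).IsMultiplicative := by
  refine ⟨by simp [omegaArith, omegaWeight], ?_⟩
  intro m n hmn
  rcases eq_or_ne m 0 with rfl | hm
  · simp [omegaArith]
  rcases eq_or_ne n 0 with rfl | hn
  · simp [omegaArith]
  rw [omegaArith_apply y (mul_ne_zero hm hn), omegaArith_apply y hm, omegaArith_apply y hn]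
  exact omegaWeight_mul y hm hn hmn

/-- `m ↦ y^{Ω(m)}` as an arithmetic function (`0 ↦ 0`). [folklore] -/
def powOmegaArith (y : R) : ArithmeticFunction R :=
  ⟨fun m => if m = 0 then 0 else y ^ cardFactors m, by simp⟩

/-- `powOmegaArith y m = y^{Ω(m)}` for `m ≠ 0`. [folklore] -/
theorem powOmegaArith_apply (y : R) {m : ℕ} (hm : m ≠ 0) : powOmegaArith y m = y ^ cardFactors m := by
  simp [powOmegaArith, hm]

/-- `m ↦ y^{Ω(m)}` is multiplicative (complete additivity of `Ω`). [folklore] -/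
theorem isMultiplicative_powOmegaArith (y : R) : (powOmegaArith y).IsMultiplicative := by
  refine ⟨by simp [powOmegaArith], ?_⟩
  intro m n hmn
  rcases eq_or_ne m 0 with rfl | hm
  · simp [powOmegaArith]
  rcases eq_or_ne n 0 with rfl | hn
  · simp [powOmegaArith]
  rw [powOmegaArith_apply y (mul_ne_zero hm hn), powOmegaArith_apply y hm, powOmegaArith_apply y hn,
    ArithmeticFunction.cardFactors_mul hm hn, pow_add]

/-- Möbius inversion on prime powers: `g_y * ζ = y^{Ω}` as arithmetic functions. [folklore] -/
theorem omegaArith_mul_zeta (y : R) :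
    omegaArith y * (ArithmeticFunction.zeta : ArithmeticFunction R) = powOmegaArith y := by
  rw [ArithmeticFunction.IsMultiplicative.eq_iff_eq_on_prime_powers _
    ((isMultiplicative_omegaArith y).mul ArithmeticFunction.isMultiplicative_zeta.natCast) _
    (isMultiplicative_powOmegaArith y)]
  intro p i hp
  rw [ArithmeticFunction.coe_mul_zeta_apply, Nat.sum_divisors_prime_pow hp,
    powOmegaArith_apply y (pow_ne_zero _ hp.ne_zero), ArithmeticFunction.cardFactors_apply_prime_pow hp]
  rw [Finset.sum_congr rfl fun j _ => by
    rw [omegaArith_apply y (pow_ne_zero _ hp.ne_zero), omegaWeight_prime_pow y hp]]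
  exact sum_omegaCoeff_range y i

/-- **THE EXPANSION** `y^{Ω(m)} = Σ_{d ∣ m} g_y(d)` for `m ≥ 1` (one non-negative divisor expansion of
the un-capped tilt; the lever of the card). [folklore] -/
theorem pow_cardFactors_eq_sum_divisors (y : R) {m : ℕ} (hm : m ≠ 0) :
    y ^ cardFactors m = ∑ d ∈ m.divisors, omegaWeight y d := by
  have h : (omegaArith y * (ArithmeticFunction.zeta : ArithmeticFunction R)) m = powOmegaArith y m := by
    rw [omegaArith_mul_zeta]
  rw [ArithmeticFunction.coe_mul_zeta_apply, powOmegaArith_apply y hm] at h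
  rw [← h]
  exact Finset.sum_congr rfl fun d hd => omegaArith_apply y (Nat.pos_of_mem_divisors hd).ne'

end Weights

/-! ### The product value and the exact statistic `Ω_f(n) = Ω(P(n))` -/

/-- THE PRODUCT VALUE `P(n) = ∏ᵢ max(fᵢ(n).toNat, 1)`: for `n ≥ n₀(f)` (all values positive) this is
`F(n) = ∏ᵢ fᵢ(n)`; the `max · 1` convention makes `Ω(P(n)) = Σᵢ Ω(fᵢ(n).toNat)` exact for EVERY `n`
(`Ω(0) = Ω(1) = 0`), so no positivity bookkeeping enters the split below. [folklore] -/
def prodVal {k : ℕ} (f : Fin k → ℤ[X]) (n : ℕ) : ℕ :=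
  ∏ i, max (((f i).eval (n : ℤ)).toNat) 1

/-- `P(n) ≥ 1`. [folklore] -/
theorem prodVal_ne_zero {k : ℕ} (f : Fin k → ℤ[X]) (n : ℕ) : prodVal f n ≠ 0 :=
  Finset.prod_ne_zero_iff.2 fun i _ => by positivity

/-- `Ω(max(v,1)) = Ω(v)` (`Ω(0) = Ω(1) = 0`). [folklore] -/
theorem cardFactors_max_one (v : ℕ) : cardFactors (max v 1) = cardFactors v := by
  rcases Nat.eq_zero_or_pos v with rfl | hv
  · simp
  · rw [max_eq_left hv]

/-- Complete additivity over a finite product of non-zero naturals. [folklore] -/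
theorem cardFactors_finset_prod {ι : Type*} (s : Finset ι) (g : ι → ℕ) (h : ∀ i ∈ s, g i ≠ 0) :
    cardFactors (∏ i ∈ s, g i) = ∑ i ∈ s, cardFactors (g i) := by
  induction s using Finset.induction_on with
  | empty => simp
  | insert a s ha ih =>
    rw [Finset.prod_insert ha, Finset.sum_insert ha,
      ArithmeticFunction.cardFactors_mul (h a (Finset.mem_insert_self a s))
        (Finset.prod_ne_zero_iff.2 fun i hi => h i (Finset.mem_insert_of_mem hi)),
      ih fun i hi => h i (Finset.mem_insert_of_mem hi)]

/-- `Ω_f(n) = Ω(P(n))` — the system statistic of the crux is the `Ω` of ONE number (the card's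
`OmegaProductExact`, with the `max · 1` convention absorbing non-positive values). [folklore] -/
theorem cardFactors_prodVal {k : ℕ} (f : Fin k → ℤ[X]) (n : ℕ) :
    cardFactors (prodVal f n) = ∑ i, cardFactors (((f i).eval (n : ℤ)).toNat) := by
  unfold prodVal
  rw [cardFactors_finset_prod _ _ fun i _ => by positivity]
  exact Finset.sum_congr rfl fun i _ => cardFactors_max_one _

/-- The crux's weight is one divisor sum: `y^{Ω_f(n)} = Σ_{d ∣ P(n)} g_y(d)` for every `n`. [folklore] -/
theorem pow_stat_eq_sum_divisors {R : Type*} [CommRing R] {k : ℕ} (f : Fin k → ℤ[X]) (y : R) (n : ℕ) :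
    y ^ (∑ i, cardFactors (((f i).eval (n : ℤ)).toNat)) = ∑ d ∈ (prodVal f n).divisors, omegaWeight y d := by
  rw [← cardFactors_prodVal, pow_cardFactors_eq_sum_divisors y (prodVal_ne_zero f n)]

/-! ### The Type-I sum, the beyond-level kernel, and the exact split -/

/-- TYPE-I PART `T_x(y) = Σ_{0 ≤ n ≤ x} Σ_{d ∣ P(n), d ≤ x} g_y(d)` (single divisors of the product value —
no divisor tuples). [folklore] -/
def typeISum {k : ℕ} (f : Fin k → ℤ[X]) (y : ℝ) (x : ℕ) : ℝ :=
  ∑ n ∈ range (x + 1), ∑ d ∈ (prodVal f n).divisors.filter (fun d => d ≤ x), omegaWeight y d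

/-- BEYOND-LEVEL KERNEL `K_x(y) = Σ_{0 ≤ n ≤ x} Σ_{d ∣ P(n), x < d} g_y(d)`. [folklore] -/
def kernelSum {k : ℕ} (f : Fin k → ℤ[X]) (y : ℝ) (x : ℕ) : ℝ :=
  ∑ n ∈ range (x + 1), ∑ d ∈ (prodVal f n).divisors.filter (fun d => x < d), omegaWeight y d

/-- **The split is exact**: `T_x(y) + K_x(y) = Σ_{0 ≤ n ≤ x} y^{Ω_f(n)}` for every family, `y`, `x`. [folklore] -/
theorem typeISum_add_kernelSum {k : ℕ} (f : Fin k → ℤ[X]) (y : ℝ) (x : ℕ) :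
    typeISum f y x + kernelSum f y x =
      ∑ n ∈ range (x + 1), y ^ (∑ i, cardFactors (((f i).eval (n : ℤ)).toNat)) := by
  rw [typeISum, kernelSum, ← Finset.sum_add_distrib]
  refine Finset.sum_congr rfl fun n _ => ?_
  rw [pow_stat_eq_sum_divisors f y n]
  have hK : (prodVal f n).divisors.filter (fun d => x < d) =
      (prodVal f n).divisors.filter (fun d => ¬ d ≤ x) :=
    Finset.filter_congr fun d _ => not_le.symm
  rw [hK, Finset.sum_filter_add_sum_filter_not]

/-- The normalised sum of the crux splits into its Type-I and kernel parts (cast to `ℂ`). [folklore] -/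
theorem normSum_eq_typeI_add_kernel {k : ℕ} (f : Fin k → ℤ[X]) (y : ℝ) (x : ℕ) :
    (x : ℂ)⁻¹ * Complex.exp ((k : ℂ) * (1 - (y : ℂ)) * (Real.log (Real.log x) : ℂ)) *
        ∑ n ∈ Finset.range (x + 1), (y : ℂ) ^ (∑ i, cardFactors (((f i).eval (n : ℤ)).toNat))
      = (x : ℂ)⁻¹ * Complex.exp ((k : ℂ) * (1 - (y : ℂ)) * (Real.log (Real.log x) : ℂ)) * (typeISum f y x : ℂ)
        + (x : ℂ)⁻¹ * Complex.exp ((k : ℂ) * (1 - (y : ℂ)) * (Real.log (Real.log x) : ℂ)) *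
          (kernelSum f y x : ℂ) := by
  rw [← mul_add, ← Complex.ofReal_add, typeISum_add_kernelSum]
  push_cast
  rfl

/-! ### Local and global Euler factors of the un-capped statistic -/

/-- LOCAL FACTOR `E_p(z) = E_n[z^{v_p(F(n))}] = 1 + (z − 1) Σ_{a ≥ 0} q_{a+1} z^a`, `q_a = ρ_F(p^a)/p^a`
the density of `{n : p^a ∣ ∏ᵢ fᵢ(n)}` (`polyRootCountMod f (p^a)` — the tree's count, at a prime POWER).
For a Bateman–Horn system `ρ_F(p^a)` is bounded in `a` (`F` squarefree, Hensel/Nagell), so the series has radius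
`≥ p ≥ 2`: `E_p` is holomorphic on `|z| < 2` (the wall at `2` through `p = 2`: `Negative.WallAtTwo/SharpRadius`);
`E_p(0) = 1 − ω_f(p)/p` (`localFactor_zero`), `E_p(1) = 1` (`localFactor_one`). [folklore] -/
def localFactor {k : ℕ} (f : Fin k → ℤ[X]) (p : ℕ) (z : ℂ) : ℂ :=
  1 + (z - 1) * ∑' a : ℕ, ((polyRootCountMod f (p ^ (a + 1)) : ℂ) / (p : ℂ) ^ (a + 1)) * z ^ a

/-- Ordered partial Euler product `λ_{F,N}(z) = ∏_{p ≤ N} E_p(z) (1 − 1/p)^{k(z−1)}`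
(`(1 − 1/p)^{k(z−1)} = exp(k(z−1) log(1 − 1/p))`, real logarithm). [folklore] -/
def eulerPartial {k : ℕ} (f : Fin k → ℤ[X]) (N : ℕ) (z : ℂ) : ℂ :=
  ∏ p ∈ Nat.primesLE N, localFactor f p z * Complex.exp ((k : ℂ) * (z - 1) * (Real.log (1 - 1 / (p : ℝ)) : ℂ))

/-- THE LINE'S EXPLICIT `Λ`: `λ_F(z) = lim_N λ_{F,N}(z)` (ordered limit, as `batemanHornConst`; junk where the
limit fails, which `stub_eulerFactor` excludes for Bateman–Horn systems on `|z| < 2`). [folklore] -/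
def eulerFactor {k : ℕ} (f : Fin k → ℤ[X]) (z : ℂ) : ℂ :=
  limUnder atTop fun N : ℕ => eulerPartial f N z

/-- Calibration `E_p(1) = 1`. [folklore] -/
theorem localFactor_one {k : ℕ} (f : Fin k → ℤ[X]) (p : ℕ) : localFactor f p 1 = 1 := by
  simp [localFactor]

/-- Calibration `λ_F(1) = 1` for EVERY family (cf. `Disproof.normSum_one_tendsto`: `H_x(1) → 1`). [folklore] -/
theorem eulerFactor_one {k : ℕ} (f : Fin k → ℤ[X]) : eulerFactor f 1 = 1 := by
  unfold eulerFactor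
  have : (fun N : ℕ => eulerPartial f N 1) = fun _ => 1 := by
    funext N
    refine Finset.prod_eq_one fun p _ => ?_
    rw [localFactor_one, sub_self, mul_zero, zero_mul, Complex.exp_zero, mul_one]
  rw [this]
  exact tendsto_const_nhds.limUnder_eq

/-- THE PIN, LOCALLY: `E_p(0) = 1 − ω_f(p)/p` at every modulus `p` (only the `a = 0` term survives `0^a`). [folklore] -/
theorem localFactor_zero {k : ℕ} (f : Fin k → ℤ[X]) (p : ℕ) :
    localFactor f p 0 = 1 - (polyRootCountMod f p : ℂ) / (p : ℂ) := by
  unfold localFactor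
  rw [tsum_eq_single 0]
  · simp only [zero_add, pow_one, pow_zero, mul_one]
    ring
  · intro a ha
    simp [zero_pow ha]

/-- `exp(k·(0−1)·log c) = (c⁻¹)^k` for `c > 0`, as complex numbers. [folklore] -/
theorem exp_natMul_neg_log {c : ℝ} (hc : 0 < c) (k : ℕ) :
    Complex.exp ((k : ℂ) * (0 - 1) * (Real.log c : ℂ)) = (((c⁻¹) ^ k : ℝ) : ℂ) := by
  have : (k : ℂ) * (0 - 1) * (Real.log c : ℂ) = ((-(k * Real.log c) : ℝ) : ℂ) := by push_cast; ring
  rw [this, ← Complex.ofReal_exp, Real.exp_neg, Real.exp_nat_mul, Real.exp_log hc, inv_pow]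

/-- THE PIN, PARTIAL PRODUCTS: at `z = 0` the `N`-th ordered partial product of the line's `Λ` IS the tree's
`batemanHornPartial f N` (coerced). [folklore] -/
theorem eulerPartial_zero {k : ℕ} (f : Fin k → ℤ[X]) (N : ℕ) :
    eulerPartial f N 0 = (batemanHornPartial f N : ℂ) := by
  unfold eulerPartial batemanHornPartial
  rw [Complex.ofReal_prod]
  refine Finset.prod_congr rfl fun p hp => ?_
  have hp' : p.Prime := Nat.prime_of_mem_primesLE hp
  have hc : (0 : ℝ) < 1 - 1 / (p : ℝ) := by
    have h2 : (2 : ℝ) ≤ p := by exact_mod_cast hp'.two_le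
    rw [sub_pos, div_lt_one (by linarith)]
    linarith
  rw [localFactor_zero, exp_natMul_neg_log hc k, Fintype.card_fin]
  push_cast
  ring

/-- **THE PIN `λ_F(0) = C(f)`, PROVED** for every Bateman–Horn system: the partial products at `0` are the
Bateman–Horn partial products, which converge to `batemanHornConst f`
(`IsBatemanHornSystem.hasBatemanHornConst_holds`, PROVED in the tree). [folklore] -/
theorem eulerFactor_zero {k : ℕ} {f : Fin k → ℤ[X]} (hf : IsBatemanHornSystem f) :
    eulerFactor f 0 = (batemanHornConst f : ℂ) := by
  unfold eulerFactor
  obtain ⟨hC, -⟩ := IsBatemanHornSystem.hasBatemanHornConst_holds hf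
  have h2 : Tendsto (fun N : ℕ => eulerPartial f N 0) atTop (𝓝 (batemanHornConst f : ℂ)) := by
    have := (Complex.continuous_ofReal.tendsto _).comp hC
    refine this.congr fun N => ?_
    simp only [Function.comp_apply, eulerPartial_zero]
  exact h2.limUnder_eq

/-- **defs_eulerFactorPin** (registered sub-goal of stmt-Parity-9770, line `product-anatomy-subcritical`):
the pin `λ_F(0) = C(f)` for every Bateman–Horn system, closed form of `eulerFactor_zero`. [folklore] -/
theorem defs_eulerFactorPin :
    ∀ (k : ℕ) (f : Fin k → ℤ[X]), IsBatemanHornSystem f → eulerFactor f 0 = (batemanHornConst f : ℂ) :=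
  fun _ _ hf => eulerFactor_zero hf

/-! ### Vocabulary of the anatomy (tails and rows) -/

/-- The `i`-th value with the `max · 1` convention. [folklore] -/
def val {k : ℕ} (f : Fin k → ℤ[X]) (i : Fin k) (n : ℕ) : ℕ :=
  max (((f i).eval (n : ℤ)).toNat) 1

/-- The system statistic `Ω_f(n)` (the crux's exponent, verbatim). [folklore] -/
def stat {k : ℕ} (f : Fin k → ℤ[X]) (n : ℕ) : ℕ :=
  ∑ i, cardFactors (((f i).eval (n : ℤ)).toNat)

/-- The `z`-smooth part of `m`: `∏_{p ≤ z} p^{v_p(m)}` (`= 1` for `m = 0`). [folklore] -/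
def smoothPart (z : ℝ) (m : ℕ) : ℕ :=
  m.factorization.prod fun p v => if (p : ℝ) ≤ z then p ^ v else 1

/-- Ordered tuples of DISTINCT primes in the boxes `(x^{αⱼ}, x^{βⱼ}]`. [folklore] -/
def boxTuples (s : ℕ) (α β : Fin s → ℝ) (x : ℕ) : Finset (Fin s → ℕ) :=
  (Fintype.piFinset fun j => (Icc 1 ⌊(x : ℝ) ^ β j⌋₊).filter fun q : ℕ => q.Prime ∧ (x : ℝ) ^ α j < (q : ℝ)).filter
    fun p => Function.Injective p

/-- Density of the mixed condition `e ∣ ∏ᵢ fᵢ(n) ∧ ∀ j, pⱼ ∣ f_{σ j}(n)` over one period `e ∏ pⱼ`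
(exact: the condition is `lcm(e, p₁, …)`-periodic and `lcm ∣ e ∏ pⱼ`). [folklore] -/
def mixedDens {k s : ℕ} (f : Fin k → ℤ[X]) (e : ℕ) (σ : Fin s → Fin k) (p : Fin s → ℕ) : ℝ :=
  (#((range (e * ∏ j, p j)).filter fun n : ℕ =>
      (e : ℤ) ∣ ∏ i, (f i).eval (n : ℤ) ∧ ∀ j, (p j : ℤ) ∣ (f (σ j)).eval (n : ℤ)) : ℝ) / (e * ∏ j, p j : ℕ)

/-- THE ROW: `R_x(e; σ, α, β) = Σ_{(pⱼ) distinct primes in boxes} #{1 ≤ n ≤ x : e ∣ F(n), pⱼ ∣ f_{σ j}(n) ∀ j}`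
— a root count of the product `F` to the modulus `e ∏ pⱼ`: the small-divisor twist `e` on the PRODUCT (single
divisor — the card's simplification), the large primes assigned to factors by `σ` (needed for `k ≥ 2`: the model is
per-factor, a linear factor `n ≤ x` cannot hold primes of total `> 1`). [folklore] -/
def cheapRow {k s : ℕ} (f : Fin k → ℤ[X]) (σ : Fin s → Fin k) (α β : Fin s → ℝ) (e x : ℕ) : ℕ :=
  ∑ p ∈ boxTuples s α β x,
    #((Icc 1 x).filter fun n : ℕ => (e : ℤ) ∣ ∏ i, (f i).eval (n : ℤ) ∧ ∀ j, (p j : ℤ) ∣ (f (σ j)).eval (n : ℤ))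

/-- Its local-density main term `x · Σ_{(pⱼ)} δ(e; σ, p)`. [folklore] -/
def cheapMain {k s : ℕ} (f : Fin k → ℤ[X]) (σ : Fin s → Fin k) (α β : Fin s → ℝ) (e x : ℕ) : ℝ :=
  (x : ℝ) * ∑ p ∈ boxTuples s α β x, mixedDens f e σ p

/-! ### Statements of the line (named predicates; the stubs quantify over systems and `y`) -/

/-- **EulerFactorClause k f**: `λ_F = eulerFactor f` is holomorphic on `|z| < 2` and `λ_F(0) = C(f)`. [folklore] -/
def EulerFactorClause (k : ℕ) (f : Fin k → ℤ[X]) : Prop :=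
  DifferentiableOn ℂ (eulerFactor f) (Metric.ball 0 2) ∧ eulerFactor f 0 = (batemanHornConst f : ℂ)

/-- **TypeILawOmega k f y** (level-`x` half): `x⁻¹ (log x)^{k(1−y)} T_x(y) → λ_F(y)/Γ(k(y−1)+1)`, normaliser
written exactly as in the crux. [folklore] -/
def TypeILawOmega (k : ℕ) (f : Fin k → ℤ[X]) (y : ℝ) : Prop :=
  Tendsto (fun x : ℕ => (x : ℂ)⁻¹ * Complex.exp ((k : ℂ) * (1 - (y : ℂ)) * (Real.log (Real.log x) : ℂ)) *
      (typeISum f y x : ℂ)) atTop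
    (𝓝 (eulerFactor f y * (Complex.Gamma ((k : ℂ) * ((y : ℂ) - 1) + 1))⁻¹))

/-- **KernelLawOmega k f y** (beyond-level half, forced complementary constant):
`x⁻¹ (log x)^{k(1−y)} K_x(y) → λ_F(y) (D^{y−1} Γ(y)^{−k} − Γ(k(y−1)+1)^{−1})`, `D = ∏ deg fᵢ`. [folklore] -/
def KernelLawOmega (k : ℕ) (f : Fin k → ℤ[X]) (y : ℝ) : Prop :=
  Tendsto (fun x : ℕ => (x : ℂ)⁻¹ * Complex.exp ((k : ℂ) * (1 - (y : ℂ)) * (Real.log (Real.log x) : ℂ)) *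
      (kernelSum f y x : ℂ)) atTop
    (𝓝 (eulerFactor f y *
      (Complex.exp (((y : ℂ) - 1) * (Real.log (∏ i, ((f i).natDegree : ℝ)) : ℂ)) * (Complex.Gamma y)⁻¹ ^ k -
        (Complex.Gamma ((k : ℂ) * ((y : ℂ) - 1) + 1))⁻¹)))

/-- **APrioriBound k f y**: `Σ_{n ≤ x} y^{Ω_f(n)} ≤ C x (log x)^{k(y−1)}` for `x ≥ 2` (order of magnitude). [folklore] -/
def APrioriBound (k : ℕ) (f : Fin k → ℤ[X]) (y : ℝ) : Prop :=
  ∃ C : ℝ, ∀ x : ℕ, 2 ≤ x → (∑ n ∈ range (x + 1), y ^ stat f n) ≤ C * ((x : ℝ) * Real.log x ^ ((k : ℝ) * (y - 1)))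

/-- **RankinTail k f y**: the `x^θ`-smooth part of a value exceeds `x^τ` only on a set of small TILTED mass
once `τ/θ` is large: `∀ ε ∃ R ∀ θ τ, Rθ ≤ τ ≤ 1 ⇒` eventually the tilted mass is `≤ ε x (log x)^{k(y−1)}`. [folklore] -/
def RankinTail (k : ℕ) (f : Fin k → ℤ[X]) (y : ℝ) : Prop :=
  ∀ ε : ℝ, 0 < ε → ∃ R : ℝ, 0 < R ∧ ∀ θ τ : ℝ, 0 < θ → R * θ ≤ τ → τ ≤ 1 →
    ∀ᶠ x : ℕ in atTop,
      (∑ n ∈ (Icc 1 x).filter (fun n : ℕ => ∃ i, (x : ℝ) ^ τ < (smoothPart ((x : ℝ) ^ θ) (val f i n) : ℝ)),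
        y ^ stat f n) ≤ ε * ((x : ℝ) * Real.log x ^ ((k : ℝ) * (y - 1)))

/-- **TopClassBound k f y**: the TOP CLASS (some `fᵢ(n)` has a prime factor `> x^{deg fᵢ − η}`) has tilted mass
`≤ ε x (log x)^{k(y−1)}` for `η = η(ε)` (the card's `TopClassTruncationOmega`, over `Icc 1 x`). [folklore] -/
def TopClassBound (k : ℕ) (f : Fin k → ℤ[X]) (y : ℝ) : Prop :=
  ∀ ε : ℝ, 0 < ε → ∃ η : ℝ, 0 < η ∧ ∀ᶠ x : ℕ in atTop,
    (∑ n ∈ (Icc 1 x).filter (fun n : ℕ => ∃ i, ∃ p ∈ (val f i n).primeFactors,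
        (x : ℝ) ^ (((f i).natDegree : ℝ) - η) < (p : ℝ)),
      y ^ stat f n) ≤ ε * ((x : ℝ) * Real.log x ^ ((k : ℝ) * (y - 1)))

/-- **BalancedClassBound k f y**: TWO distinct primes `> x^{1−δ}` dividing `P(n)` is a thin class
(claimed only for total degree `≤ 2`: for a cubic it has positive tilted mass). [folklore] -/
def BalancedClassBound (k : ℕ) (f : Fin k → ℤ[X]) (y : ℝ) : Prop :=
  ∀ ε : ℝ, 0 < ε → ∃ δ : ℝ, 0 < δ ∧ ∀ᶠ x : ℕ in atTop,
    (∑ n ∈ (Icc 1 x).filter (fun n : ℕ => ∃ p ∈ (prodVal f n).primeFactors, ∃ q ∈ (prodVal f n).primeFactors,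
        p ≠ q ∧ (x : ℝ) ^ (1 - δ) < (p : ℝ) ∧ (x : ℝ) ^ (1 - δ) < (q : ℝ)),
      y ^ stat f n) ≤ ε * ((x : ℝ) * Real.log x ^ ((k : ℝ) * (y - 1)))

/-- **CheapRows k f** — THE OPEN INPUT (sub-critical, smooth moduli, positive main terms, `y`-free): for every
margin `η₀ > 0`, every assignment `σ` of boxes `(x^{αⱼ}, x^{βⱼ}]` to factors with parts `≤ 1 − η₀`, per-factor
totals `≤ deg fᵢ − η₀` and cheap shapes (`max + total ≤ deg fᵢ + η₀` per factor; the `+η₀` is the mesh allowance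
for the boundary layer `u₁ ≈ u₂` of the drop-the-max identity), and every twist level `η' ≤ η₀/2`: eventually in
`x`, UNIFORMLY over twists `1 ≤ e ≤ x^{η'}` all of whose primes lie below every box,
`R_x(e; σ, α, β) = (1 + o(1)) · x Σ δ` (relative error).  Modulus `e ∏ pⱼ ≤ x^{Σdegᵢ − η₀/2}`. [folklore] -/
def CheapRows (k : ℕ) (f : Fin k → ℤ[X]) : Prop :=
  ∀ η₀ : ℝ, 0 < η₀ → ∀ (s : ℕ) (σ : Fin s → Fin k) (α β : Fin s → ℝ),
    (∀ j, 0 < α j ∧ α j < β j ∧ β j ≤ 1 - η₀) →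
    (∀ i : Fin k, (∑ j ∈ univ.filter (fun j => σ j = i), β j) ≤ ((f i).natDegree : ℝ) - η₀) →
    (∀ j, β j + (∑ j' ∈ univ.filter (fun j' => σ j' = σ j), β j') ≤ ((f (σ j)).natDegree : ℝ) + η₀) →
    ∀ η' : ℝ, 0 < η' → 2 * η' ≤ η₀ → ∀ ε : ℝ, 0 < ε →
      ∀ᶠ x : ℕ in atTop, ∀ e : ℕ, 1 ≤ e → (e : ℝ) ≤ (x : ℝ) ^ η' →
        (∀ q ∈ e.primeFactors, ∀ j, (q : ℝ) ≤ (x : ℝ) ^ α j) →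
          |(cheapRow f σ α β e x : ℝ) - cheapMain f σ α β e x| ≤ ε * cheapMain f σ α β e x


end

end Summit.Parity.BatemanHorn.Cruxes.LSDRealSegment.ProductAnatomySubcritical
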